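import Literature.IUT.LogThetaLattice.GlobalLGPFrobenioidsModFrakRlfModel
import Literature.IUT.LogThetaLattice.ThetaPilotObjectsFrakModel
import Literature.IUT.LogThetaLattice.GlobalLGPFrobenioidsRealifiedRatFn
import HarnessLib

/-!
# [FrdI] Ex. 6.3 `deg^arith` vs [IUTchIII] Prop. 3.9 (iii) at the model: the global degree of the realified integral
# family IS MINUS layer L1's arithmetic degree (abc-iut cell, layer L6; sub-row «J1-rlf-bridge», degree clause;
# proof-only; written by abc-iut-w4-d015)

S. Mochizuki, *The geometry of Frobenioids I*, Example 6.3 p. 113 ("`deg^arith_L : ArithDiv(L) → ℝ`,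
`Σ n_v [v] ↦ Σ n_v log N(v) + …`") and Thm. 6.4 (i) p. 115 ("the homomorphism `(Φ^rlf)^gp(L) = ArithDiv_ℝ(L) → ℝ`
given by `deg_L^arith`") [cite: MochizukiFrdI2008, Ex. 6.3 p.113]; S. Mochizuki, *Inter-universal Teichmüller theory
III*, Prop. 3.9 (iii) p. 117 ("the global log-volume … is equal to the degree of the arithmetic line bundle
determined by `𝔍`") and Example 3.6 (ii) p. 108 [claim: Mochizuki2012, status: disputed].

WHAT. The two degree conventions of the cell for ONE integral family `𝔍 ∈ (†𝓕⊛_𝔪𝔬𝔡)_α` of abc-iut-w4-d005's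
integral datum: layer L1's `arithDegree F : ArithDivisor F →+ ℝ` (abc-iut-L1-t3, [FrdI] Ex. 6.3) read through
`Prop37.frakObjAddEquivArith` (abc-iut-w4-d015, "Φ(∗)^gp = ⊕_v ord(F_v)"), and layer L6's `GlobalFrobenioidModels.frakDeg`
(abc-iut-L6-d3: the global degree `deg_F` of the ℝ-arithmetic divisor `−Σ_v [F_v:ℝ][λ_v]·v` of the family, =
[IUTchIII] Prop. 3.9 (iii)'s global log-volume by `globalLogVolume_frakRegion`) read through abc-iut-w4-d005's
realification on objects `realifyObj`. PROVED (no definition introduced):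

* `realifyObj_frakObjOfCoords_single` / `frakDivisor_realifyObj_frakObjOfCoords_arch` — the two one-place cases;
* **`frakDeg_realifyObj : frakDeg (realifyObj F J) = − arithDegree F (frakObjAddEquivArith F J)`** — the sign is the
  `𝒪(−D)` convention of abc-iut-L6-d3's `frakDivisor` (`𝔭_v^n 𝒪_v ↦ −n·v`, documented there);
* `globalLogVolume_frakRegion_realifyObj` — [IUTchIII] Prop. 3.9 (iii) for realified integral families in [FrdI]
  Ex. 6.3's currency: `μ^log(𝔍) = − deg^arith(𝔍)`;
* `frakDeg_rlfEquivModel_iotaRlf` — the same along THE identification `Φ(∗)^rlf ≅ Φ^ℝ(∗)` of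
  `GlobalLGPFrobenioidsModFrakRlfModel.lean` ([FrdI] Thm. 6.4 (i) "given by `deg^arith`").

Nothing here asserts a disputed claim or takes a side on [IUTchIII] Cor. 3.12; typed ≠ discharged; instantiated ≠
endorsed.
-/

noncomputable section

open scoped NNReal

namespace Literature.IUT.LogThetaLattice

namespace Prop37

open NumberField IsDedekindDomain GlobalFrobenioidModels Literature.AlgebraicGeometry.Frobenioids
  Literature.IUT.LogVolume

variable (F : Type) [Field F] [NumberField F]

/-! ### The two one-place cases -/

/-- The realification of the integral family `n·[w(v₀)]` supported at ONE finite place is the embedded finite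
divisor `n·[v₀]` (abc-iut-w4-d015 `ofFinDivisorFrak`). [cite: MochizukiFrdI2008, Ex. 6.3 p.113] -/
theorem realifyObj_frakObjOfCoords_single (w : FinitePlace F) (n : ℤ) :
    realifyObj F (frakObjOfCoords F (Finsupp.single w n) 0) =
      ofFinDivisorFrak (Finsupp.single (FinitePlace.maximalIdeal w) (n : ℝ)) := by
  classical
  refine FrakObj.ext_cls (funext fun p => ?_)
  rcases p with v | w'
  · rw [realifyObj_cls, realifyCls_inl, frakObjOfCoords_cls_inr, ofFinDivisorFrak_cls_inl]
    by_cases h : v = FinitePlace.maximalIdeal w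
    · subst h
      rw [FinitePlace.mk_maximalIdeal, Finsupp.single_eq_same, Finsupp.single_eq_same]
    · have h' : FinitePlace.mk v ≠ w := fun h'' => h (by rw [← h'', FinitePlace.maximalIdeal_mk])
      rw [Finsupp.single_eq_of_ne h', Finsupp.single_eq_of_ne h, Int.cast_zero]
  · rw [realifyObj_cls, realifyCls_inr, frakObjOfCoords_cls_inl, ofFinDivisorFrak_cls_inr, Pi.zero_apply]

/-- The ℝ-arithmetic divisor of the realification of the integral family `t·[w₀]` supported at ONE archimedean
place is `−[F_{w₀}:ℝ]·t·[w₀]` (abc-iut-L6-d3's `𝒪(−D)` convention with the weight `[F_v:ℝ]`).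
[cite: MochizukiFrdI2008, Ex. 6.3 p.113] -/
theorem frakDivisor_realifyObj_frakObjOfCoords_arch [DecidableEq (InfinitePlace F)] (w : InfinitePlace F) (t : ℝ) :
    frakDivisor (realifyObj F (frakObjOfCoords F 0 (Pi.single w t))) =
      ADivisor.of (Sum.inl w) (-((w.mult : ℝ) * t)) := by
  classical
  ext p
  rw [frakDivisor_apply, Finsupp.single_apply]
  rcases p with w' | v
  · rw [Sum.swap_inl, realifyObj_cls, realifyCls_inr, frakObjOfCoords_cls_inl, placeMult_inl]
    by_cases h : w' = w
    · subst h; rw [Pi.single_eq_same, if_pos rfl]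
    · rw [Pi.single_eq_of_ne h, mul_zero, neg_zero, if_neg (fun h'' => h (Sum.inl_injective h''.symm))]
  · rw [Sum.swap_inr, realifyObj_cls, realifyCls_inl, frakObjOfCoords_cls_inr, Finsupp.coe_zero, Pi.zero_apply,
      Int.cast_zero, mul_zero, neg_zero, if_neg Sum.inl_ne_inr]

/-! ### The global degree of a realified integral family is minus its arithmetic degree -/

/-- The finite one-place case of `frakDeg_realifyObj`. [cite: MochizukiFrdI2008, Ex. 6.3 p.113] -/
theorem frakDeg_realifyObj_single (w : FinitePlace F) (n : ℤ) :
    frakDeg (realifyObj F (frakObjOfCoords F (Finsupp.single w n) 0)) =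
      -arithDegree F (Finsupp.single w n, 0) := by
  rw [realifyObj_frakObjOfCoords_single, frakDeg_ofFinDivisorFrak, FinDivisor.deg_of, arithDegree_apply]
  simp [logNorm, Finsupp.sum_single_index]

/-- The archimedean one-place case of `frakDeg_realifyObj`. [cite: MochizukiFrdI2008, Ex. 6.3 p.113] -/
theorem frakDeg_realifyObj_arch [DecidableEq (InfinitePlace F)] (w : InfinitePlace F) (t : ℝ) :
    frakDeg (realifyObj F (frakObjOfCoords F 0 (Pi.single w t))) = -arithDegree F (0, Pi.single w t) := by
  rw [frakDeg, frakDivisor_realifyObj_frakObjOfCoords_arch, degF_of_inl, arithDegree_apply]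
  simp only [Finsupp.sum_zero_index, zero_add]
  rw [Finset.sum_eq_single w (fun w' _ hw' => by rw [Pi.single_eq_of_ne hw', mul_zero])
    (fun h => absurd (Finset.mem_univ w) h), Pi.single_eq_same]

/-- **`frakDeg (realifyObj 𝔍) = − deg^arith(𝔍)`** for EVERY integral family `𝔍` of `(†𝓕⊛_𝔪𝔬𝔡)_α`: abc-iut-L6-d3's
global degree of the realified family ([IUTchIII] Prop. 3.9 (iii) / Ex. 3.6 (ii), `𝒪(−D)` convention) is minus layer
L1's [FrdI] Ex. 6.3 arithmetic degree of the same family read as an arithmetic divisor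
(`Prop37.frakObjAddEquivArith`). Proof: both sides are additive in `𝔍`, so it suffices to compare them on the
one-place families (`Finsupp.addHom_ext`, `AddMonoidHom.functions_ext`). [cite: MochizukiFrdI2008, Ex. 6.3 p.113] -/
theorem frakDeg_realifyObj (J : FrakObj (Places F) (Gamma F)) :
    frakDeg (realifyObj F J) = -arithDegree F (frakObjAddEquivArith F J) := by
  classical
  -- both sides as additive maps out of `ArithDivisor F`
  let L : ArithDivisor F →+ ℝ :=
    { toFun := fun d => frakDeg (realifyObj F ((frakObjAddEquivArith F).symm d))
      map_zero' := by rw [map_zero, ← realifyObjHom_apply, map_zero, frakDeg_zero]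
      map_add' := fun d e => by
        rw [map_add, ← realifyObjHom_apply, map_add, realifyObjHom_apply, realifyObjHom_apply, frakDeg_add] }
  let R : ArithDivisor F →+ ℝ := -arithDegree F
  have hfin : L.comp (AddMonoidHom.inl _ _) = R.comp (AddMonoidHom.inl _ _) := by
    refine Finsupp.addHom_ext fun w n => ?_
    show frakDeg (realifyObj F ((frakObjAddEquivArith F).symm (Finsupp.single w n, 0))) =
      -arithDegree F (Finsupp.single w n, 0)
    exact frakDeg_realifyObj_single F w n
  have harc : L.comp (AddMonoidHom.inr _ _) = R.comp (AddMonoidHom.inr _ _) := by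
    refine AddMonoidHom.functions_ext _ _ _ fun w t => ?_
    show frakDeg (realifyObj F ((frakObjAddEquivArith F).symm (0, Pi.single w t))) = -arithDegree F (0, Pi.single w t)
    exact frakDeg_realifyObj_arch F w t
  have hLR : L = R := by
    refine AddMonoidHom.ext fun d => ?_
    have hd : d = AddMonoidHom.inl _ _ d.1 + AddMonoidHom.inr _ _ d.2 := by
      ext <;> simp
    rw [hd, map_add, map_add, ← AddMonoidHom.comp_apply, hfin, ← AddMonoidHom.comp_apply, harc]
    rfl
  have h := DFunLike.congr_fun hLR (frakObjAddEquivArith F J)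
  simp only [L, R, AddMonoidHom.coe_mk, ZeroHom.coe_mk, AddEquiv.symm_apply_apply, AddMonoidHom.neg_apply] at h
  exact h

/-- **[IUTchIII] Prop. 3.9 (iii) for realified integral families, in [FrdI] Ex. 6.3's currency**: the global
log-volume of the region of `realifyObj 𝔍` (abc-iut-L6-d3's `globalLogVolume_frakRegion`) is `− deg^arith(𝔍)`.
[claim: Mochizuki2012, status: disputed] -/
theorem globalLogVolume_frakRegion_realifyObj (J : FrakObj (Places F) (Gamma F)) :
    globalLogVolume (divisorLogVolume F) (frakRegion (realifyObj F J)) = -arithDegree F (frakObjAddEquivArith F J) := by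
  rw [globalLogVolume_frakRegion, frakDeg_realifyObj]

/-- The same for EFFECTIVE families, through `Prop37.effDivAddEquivArith` and L1's inclusion `Φ(F) ⊆ Φ(F)^gp`.
[cite: MochizukiFrdI2008, Ex. 6.3 p.113] -/
theorem frakDeg_realifyEff (D : effDiv (Places F) (Gamma F) (nonneg F)) :
    frakDeg (realifyEff F D : FrakObj (ModelPlaces F) (fun _ => ℝ)) =
      -arithDegree F (EffArithDivisor.toArithDivisor F (effDivAddEquivArith F D)) := by
  rw [coe_realifyEff, frakDeg_realifyObj, toArithDivisor_effDivAddEquivArith]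

/-- **[FrdI] Thm. 6.4 (i) "the homomorphism `(Φ^rlf)^gp(L) = ArithDiv_ℝ(L) → ℝ` given by `deg^arith_L`" along THE
identification `Φ(∗)^rlf ≅ Φ^ℝ(∗)`**: abc-iut-L6-d3's degree of the image under `Prop37.rlfEquivModel` of `ι(D)`,
`D ∈ Φ(∗)`, is `− deg^arith(D)`. [cite: MochizukiFrdI2008, Thm. 6.4 (i) p.115] -/
theorem frakDeg_rlfEquivModel_iotaRlf (D : EffDiv (Places F) (Gamma F) (nonneg F)) :
    frakDeg ((rlfEquivModel F (iotaRlf F D)).toAdd : FrakObj (ModelPlaces F) (fun _ => ℝ)) =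
      -arithDegree F (EffArithDivisor.toArithDivisor F (effDivAddEquivArith F D.toAdd)) := by
  rw [rlfEquivModel_iotaRlf, realifyEffMul_apply, toAdd_ofAdd, frakDeg_realifyEff]

end Prop37

end Literature.IUT.LogThetaLattice

end
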